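import Literature.Computability.Cryptography.LWERegevSampling
import Literature.Computability.Cryptography.LWERegevAsymptotics
import Literature.Computability.Cryptography.LWEHardness
import HarnessLib

/-!
# Regev's decision-to-search reduction, VI: the answer bits, the selectors, and the machine specification

Topic `Computability/Cryptography` (LWE), grouping namespace `LWE.RegevReduction` for the
reduction's objects. This file is the interface between the ANALYSIS of the reduction
(`LWERegevCore.lean` … `LWERegevSampling.lean`, `LWERegevAsymptotics.lean`) and its oracle
MACHINE (the polynomial-time query generator and output map of `regev_decision_to_search`,
`LWEHardness.lean`):

* `countB`, `devB`, `scoreB`, `candB`, **`outputB`** — the output of the reduction as a function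
  of the family of ANSWER BITS alone (one bit per query `(j, e, rep)`: does the oracle accept the
  queried block?), and `output_eq_outputB`, `algOut_eq_outputB`: the analysed output factors
  through the bits of the queried blocks **`queryBlock K S' r qi`** (spelled out samplewise in
  `queryBlock_none`, `queryBlock_some`);
* the concrete selectors the machine implements: **`firstArgmax`** (first round of maximal score,
  scanning `j = 0, 1, …`; a new round replaces the current one iff its score is strictly larger)
  and **`firstArgmin`** (first guess `k = 0, 1, …, q-1` of minimal deviation), with
  `isMaxSel_firstArgmax`, `isMinSel_firstArgmin`;
* `accBit` (the accept bit of an answer string: first bit `1`, i.e. `IsAccepting`);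
* **`RegevMachine c c'`** — the specification of the machine: two `FP` string functions `Q`, `G`
  such that, on the code `⟨⟨encodeLWESamples S', r⟩, 1^ι⟩` with `ι` the number of query
  `qi = (j, e, rep)`, `Q` returns `encodeLWESamples (queryBlock n S' r qi)` (`K = n`, parameters
  `Tpar`, `Npar`), and on `⟨⟨encodeLWESamples S', r⟩, code of the answers⟩`, `G` returns
  `encodeSecret (outputB firstArgmax firstArgmin 0 (accept bits of the answers))`. The assembly
  `regev_decision_to_search` ← `RegevMachine` is `LWERegevDecisionToSearch.lean`.

## References

* O. Regev, *On lattices, learning with errors, random linear codes, and cryptography*, J. ACM 56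
  (2009), art. 34, §4, Lemmas 4.1–4.2 (held: arXiv:2401.03703, p. 23). [cite: RegevLWE2009, §4 Lemma 4.1–4.2]
-/

noncomputable section

namespace Literature.Computability.Cryptography

open Finset Literature.Computability.Complexity

namespace LWE

namespace RegevReduction

set_option synthInstance.maxSize 512

variable {n q m N T : ℕ}

/-! ### The output as a function of the answer bits -/

/-- The number of accepting repetitions of estimate `e` in round `j`, read off the answer bits.
[cite: RegevLWE2009, §4 (proof of Lemma 4.1)] -/
def countB (β : QIdx n q N T → Bool) (j : Fin T) (e : Est n q) : ℕ :=
  (univ.filter fun rep : Fin N => β (j, e, rep) = true).card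

/-- The deviation `|count (i,k) - count none|` in round `j`, from the bits. [cite: RegevLWE2009, §4 (proof of Lemma 4.2)] -/
def devB (β : QIdx n q N T → Bool) (j : Fin T) (i : Fin n) (k : ZMod q) : ℕ :=
  ((countB β j (some (i, k)) : ℤ) - countB β j none).natAbs

/-- The candidate secret of round `j`, from the bits. [cite: RegevLWE2009, §4 (proof of Lemma 4.2)] -/
def candB (sel : (ZMod q → ℕ) → ZMod q) (β : QIdx n q N T → Bool) (j : Fin T) : Secret n q :=
  fun i => sel fun k => devB β j i k

variable [NeZero q]

/-- The score of round `j` at the reference coordinate, from the bits. [cite: RegevLWE2009, §4 (proof of Lemma 4.1)] -/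
def scoreB (β : QIdx n q N T → Bool) (j : Fin T) (i₀ : Fin n) : ℕ :=
  univ.sup fun k : ZMod q => devB β j i₀ k

/-- **The output of the reduction from the answer bits**: the candidate of a round of maximal
score. [cite: RegevLWE2009, §4 Lemma 4.1–4.2] -/
def outputB (selT : (Fin T → ℕ) → Fin T) (sel : (ZMod q → ℕ) → ZMod q) (i₀ : Fin n)
    (β : QIdx n q N T → Bool) : Secret n q :=
  candB sel β (selT fun j => scoreB β j i₀)

/-- The answer bits of the outer data: does `D` accept the block queried for `(j, e, rep)`?
[cite: RegevLWE2009, §4 Lemma 4.1–4.2] -/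
def bitsOf (D : Block n q m → Bool) (Ω : Outer n q m N T) : QIdx n q N T → Bool :=
  fun qi => D (query (Ω qi.1).1 qi.2.1 ((Ω qi.1).2 qi.2.1 qi.2.2))

/-- **The analysed output factors through the answer bits.** [folklore] -/
theorem output_eq_outputB (D : Block n q m → Bool) (selT : (Fin T → ℕ) → Fin T) (sel : (ZMod q → ℕ) → ZMod q)
    (i₀ : Fin n) (Ω : Outer n q m N T) : output D selT sel i₀ Ω = outputB selT sel i₀ (bitsOf D Ω) :=
  rfl

/-- **The block queried for `qi = (j, e, rep)`** by the reduction on flat data `S'` and coins `r`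
(`K`-bit chunks): the piece of round `j`, estimate `e`, repetition `rep`, transformed.
[cite: RegevLWE2009, §4 (proofs of Lemmas 4.1, 4.2)] -/
def queryBlock (K : ℕ) (S' : Fin (T * (n * q + 1) * N * m) → (Fin n → ZMod q) × ZMod q) (r : List Bool)
    (qi : QIdx n q N T) : Block n q m :=
  query (assemble (scalarsOf K r) (S' ∘ slotEquiv n q m N T) qi.1).1 qi.2.1
    ((assemble (scalarsOf K r) (S' ∘ slotEquiv n q m N T) qi.1).2 qi.2.1 qi.2.2)

/-- The shift of round `j` read off the coins: coordinate `i` is chunk number `i + n j`.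
[cite: RegevLWE2009, §4 (proof of Lemma 4.1)] -/
def shiftOf (K : ℕ) (r : List Bool) (j : Fin T) : Secret n q :=
  fun i => chunkVal K q r (i + n * j)

/-- The fresh scalar `l` of sample `idx` of query `qi`: chunk number `T n + (idx + m · qi#)`.
[cite: RegevLWE2009, §4 (proof of Lemma 4.2)] -/
def freshOf (K : ℕ) (r : List Bool) (qi : QIdx n q N T) (idx : Fin m) : ZMod q :=
  chunkVal K q r (T * n + (idx + m * (qIdxEquiv n q N T qi).val))

/-- The input sample in slot `idx` of query `qi`: sample number `idx + m · qi#`.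
[cite: RegevLWE2009, §4 Lemma 4.1–4.2] -/
def inputOf (S' : Fin (T * (n * q + 1) * N * m) → (Fin n → ZMod q) × ZMod q) (qi : QIdx n q N T) (idx : Fin m) :
    (Fin n → ZMod q) × ZMod q :=
  S' (slotEquiv n q m N T (qi, idx))

/-- **The queried block for a plain estimate** (`e = none`): every input sample of the block
shifted by the round's shift. [cite: RegevLWE2009, §4 (proof of Lemma 4.1)] -/
theorem queryBlock_none (K : ℕ) (S' : Fin (T * (n * q + 1) * N * m) → (Fin n → ZMod q) × ZMod q)
    (r : List Bool) (j : Fin T) (rep : Fin N) (idx : Fin m) :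
    queryBlock K S' r (j, none, rep) idx = shiftSample (shiftOf K r j) (inputOf S' (j, none, rep) idx) := by
  unfold queryBlock inputOf shiftOf scalarsOf
  simp only [query, assemble, Function.comp_apply, posEquiv_inl_val]

/-- **The queried block for a coordinate test** (`e = some (i, k)`): every input sample
coordinate-tested with its fresh scalar, then shifted. [cite: RegevLWE2009, §4 (proof of Lemma 4.2)] -/
theorem queryBlock_some (K : ℕ) (S' : Fin (T * (n * q + 1) * N * m) → (Fin n → ZMod q) × ZMod q)
    (r : List Bool) (j : Fin T) (i : Fin n) (k : ZMod q) (rep : Fin N) (idx : Fin m) :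
    queryBlock K S' r (j, some (i, k), rep) idx =
      shiftSample (shiftOf K r j)
        (coordSample i k (freshOf K r (j, some (i, k), rep) idx) (inputOf S' (j, some (i, k), rep) idx)) := by
  unfold queryBlock inputOf shiftOf freshOf scalarsOf
  simp only [query, assemble, Function.comp_apply, posEquiv_inl_val, posEquiv_inr_val, slotEquiv_apply_val]

/-- **`algOut` through the bits of the queried blocks.** [folklore] -/
theorem algOut_eq_outputB (D : Block n q m → Bool) (selT : (Fin T → ℕ) → Fin T) (sel : (ZMod q → ℕ) → ZMod q)
    (i₀ : Fin n) (K : ℕ) (S' : Fin (T * (n * q + 1) * N * m) → (Fin n → ZMod q) × ZMod q) (r : List Bool) :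
    algOut D selT sel i₀ K S' r = outputB selT sel i₀ fun qi => D (queryBlock K S' r qi) :=
  rfl

/-! ### The selectors -/

omit [NeZero q] in
/-- A scan keeping the first best element: every scanned element is at most the result, for the
preorder "`a` is at most `b`" given by `le`, when the step replaces the kept element exactly by a
strictly better one. [folklore] -/
theorem foldl_keep_best {α : Type} (f : α → ℕ) (step : α → α → α)
    (hb : ∀ b a, f b ≤ f (step b a)) (ha : ∀ b a, f a ≤ f (step b a)) :
    ∀ (l : List α) (b : α), f b ≤ f (l.foldl step b) ∧ ∀ a ∈ l, f a ≤ f (l.foldl step b)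
  | [], b => ⟨le_rfl, fun a ha => by simp at ha⟩
  | a :: l, b => by
    have ih := foldl_keep_best f step hb ha l (step b a)
    refine ⟨(hb b a).trans ih.1, fun a' ha' => ?_⟩
    rw [List.foldl_cons]
    rcases List.mem_cons.1 ha' with rfl | h
    · exact (ha b _).trans ih.1
    · exact ih.2 a' h

omit [NeZero q] in
/-- **The first round of maximal score**: scan `j = 0, 1, …, T-1`, replacing the kept round iff
the new score is strictly larger. [cite: RegevLWE2009, §4 (proof of Lemma 4.1: "If the two estimates differ by more than … then we stop")] -/
def firstArgmax (hT : 0 < T) (f : Fin T → ℕ) : Fin T :=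
  (List.finRange T).foldl (fun b j => if f b < f j then j else b) ⟨0, hT⟩

omit [NeZero q] in
/-- `firstArgmax` returns a round of maximal value. [folklore] -/
theorem isMaxSel_firstArgmax (hT : 0 < T) : IsMaxSel (firstArgmax hT) := by
  intro f j
  have h := foldl_keep_best f (fun b j => if f b < f j then j else b)
    (fun b a => by by_cases h : f b < f a <;> simp only [h, if_true, if_false] <;> omega)
    (fun b a => by by_cases h : f b < f a <;> simp only [h, if_true, if_false] <;> omega) (List.finRange T) ⟨0, hT⟩
  exact h.2 j (List.mem_finRange j)

/-- **The first guess of minimal deviation**: scan `k = 0, 1, …, q-1` (as elements of `ℤ_q`),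
replacing the kept guess iff the new deviation is strictly smaller. [cite: RegevLWE2009, §4 (proof of Lemma 4.2: "we can try all of them")] -/
def firstArgmin (f : ZMod q → ℕ) : ZMod q :=
  ((List.range q).map fun k : ℕ => (k : ZMod q)).foldl (fun b k => if f k < f b then k else b) 0

/-- `firstArgmin` returns a guess of minimal value. [folklore] -/
theorem isMinSel_firstArgmin : IsMinSel (firstArgmin (q := q)) := by
  intro f k
  -- apply the scan lemma to the order-reversed values `M - f` with `M` a bound
  classical
  set M : ℕ := univ.sup f + 1 with hM
  have hfM : ∀ k, f k < M := fun k => Nat.lt_succ_of_le (Finset.le_sup (f := f) (mem_univ k))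
  have h := foldl_keep_best (fun k => M - f k) (fun b k => if f k < f b then k else b)
    (fun b a => by
      by_cases h : f a < f b <;> simp only [h, if_true, if_false]
      · have := hfM a; have := hfM b; omega
      · exact le_rfl)
    (fun b a => by
      by_cases h : f a < f b <;> simp only [h, if_true, if_false]
      · exact le_rfl
      · have := hfM a; have := hfM b; omega)
    ((List.range q).map fun k : ℕ => (k : ZMod q)) 0
  have hk : k ∈ (List.range q).map fun k : ℕ => (k : ZMod q) :=
    List.mem_map.2 ⟨k.val, List.mem_range.2 k.val_lt, ZMod.natCast_zmod_val k⟩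
  have h2 := h.2 k hk
  have := hfM k
  have := hfM (firstArgmin f)
  change M - f k ≤ M - f (firstArgmin f) at h2
  omega

end RegevReduction

end LWE

/-! ### The length of the sample code -/

section LengthFacts

open _root_.Computability

/-- Length of an iterated-`boolPair` list code: at least two symbols per item. [folklore] -/
theorem two_mul_length_le_length_foldr_boolPair {α : Type} (f : α → List Bool) (l : List α) :
    2 * l.length ≤ (l.foldr (fun a acc => boolPair (f a) acc) []).length := by
  induction l with
  | nil => simp
  | cons a l ih => simp only [List.foldr_cons, length_boolPair, List.length_cons]; omega

/-- `|1ᵏ| = k` (local helper). [folklore] -/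
private theorem length_unaryEncodeNat' : ∀ k : ℕ, (unaryEncodeNat k).length = k
  | 0 => rfl
  | k + 1 => by simp [unaryEncodeNat, length_unaryEncodeNat' k]

/-- Every item of an iterated-`boolPair` list code with items of length `≥ B` costs `≥ 2B + 2`
symbols. [folklore] -/
theorem mul_le_length_foldr_boolPair {α : Type} (f : α → List Bool) {B : ℕ} (hB : ∀ a, B ≤ (f a).length)
    (l : List α) : l.length * (2 * B + 2) ≤ (l.foldr (fun a acc => boolPair (f a) acc) []).length := by
  induction l with
  | nil => simp
  | cons a l ih =>
    simp only [List.foldr_cons, length_boolPair, List.length_cons]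
    have := hB a
    nlinarith

/-- **The code of `m` samples of dimension `n` has length `≥ m (2n + 2)`** (whatever the residues):
each sample code starts with the unary dimension header `1ⁿ` of its vector part. (A sharper
companion of `LWE.le_length_encodeLWESamples` of `LWESampleCodes.lean`, which gives `n, |bin q|, m ≤ |x|`;
the product bound is what makes `T n ≤ |x|` and `#samples ≤ |x|` available to the machine.) [folklore] -/
theorem mul_le_length_encodeLWESamples {n q m : ℕ} (S : Fin m → (Fin n → ZMod q) × ZMod q) :
    m * (2 * n + 2) ≤ (encodeLWESamples S).length := by
  let E := (encodingFinVec encodingNatBool n).pairBool encodingNatBool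
  let v : Fin m → (Fin n → ℕ) × ℕ := fun j => (fun i => ((S j).1 i).val, ((S j).2).val)
  have hitem : ∀ a : (Fin n → ℕ) × ℕ, n ≤ (E.encode a).length := by
    intro a
    show n ≤ (boolPair (boolPair (unaryEncodeNat (List.ofFn a.1).length)
      ((List.ofFn a.1).foldr (fun b acc => boolPair (encodeNat b) acc) [])) (encodeNat a.2)).length
    simp only [length_boolPair, length_unaryEncodeNat', List.length_ofFn]
    omega
  have h := mul_le_length_foldr_boolPair _ hitem (List.ofFn v)
  rw [List.length_ofFn] at h
  have h2 : ((List.ofFn v).foldr (fun a acc => boolPair (E.encode a) acc) []).length ≤ (encodeLWESamples S).length := by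
    show _ ≤ (boolPair (encodeNat n) (boolPair (encodeNat q) (boolPair (unaryEncodeNat (List.ofFn v).length)
      ((List.ofFn v).foldr (fun a acc => boolPair (E.encode a) acc) [])))).length
    simp only [length_boolPair]
    omega
  exact h.trans h2

end LengthFacts

/-! ### The machine specification -/

open LWE LWE.RegevReduction _root_.Computability

/-- The accept bit of an answer string: is its first bit `1` (`IsAccepting`)? [cite: AroraBarak2009, Def. 10.9] -/
def accBit (a : List Bool) : Bool := decide (IsAccepting a)

set_option synthInstance.maxSize 512 in
/-- **Specification of the oracle machine of Regev's decision-to-search reduction** for the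
exponents `c` (advantage `1/n^c`) and `c'` (error `1/n^{c'}`): a query generator `Q` and an
output map `G`, both polynomial-time string functions, such that for every dimension `n ≥ 1`,
modulus `q ≥ 1`, block size `m ≥ 1`, with `T = Tpar c c' n`, `N = Npar c c' n q`, `K = n`,
every flat tuple `S'` of `T (nq+1) N m` samples and every coin string `r`:
`Q ⟨⟨encodeLWESamples S', r⟩, 1^{qi#}⟩ = encodeLWESamples (queryBlock n S' r qi)` for every query
index `qi`, and `G ⟨⟨encodeLWESamples S', r⟩, code of answers⟩ = encodeSecret (outputB …)` of the
accept bits of the answers numbered `qi#`, for every answer list at least `T (nq+1) N` long (both for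
coin strings of the length `|encodeLWESamples S'|²` the transducer uses).
[cite: RegevLWE2009, §4 Lemma 4.1–4.2] -/
structure RegevMachine (c c' : ℕ) where
  /-- The query generator. -/
  Q : List Bool → List Bool
  /-- The output map. -/
  G : List Bool → List Bool
  /-- `Q` is polynomial-time. -/
  Q_mem : Q ∈ FP
  /-- `G` is polynomial-time. -/
  G_mem : G ∈ FP
  /-- `Q` produces the code of the queried block. -/
  Q_spec : ∀ (n q m : ℕ) [NeZero q], 0 < n → 0 < m →
    ∀ (S' : Fin (Tpar c c' n * (n * q + 1) * Npar c c' n q * m) → (Fin n → ZMod q) × ZMod q) (r : List Bool),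
      r.length = (encodeLWESamples S').length ^ 2 → ∀ (qi : QIdx n q (Npar c c' n q) (Tpar c c' n)),
      Q (boolPair (boolPair (encodeLWESamples S') r)
          (List.replicate (qIdxEquiv n q (Npar c c' n q) (Tpar c c' n) qi).val true)) =
        encodeLWESamples (queryBlock n S' r qi)
  /-- `G` produces the code of the output secret from the accept bits of the answers. -/
  G_spec : ∀ (n q m : ℕ) [NeZero q] (hn : 0 < n), 0 < m →
    ∀ (S' : Fin (Tpar c c' n * (n * q + 1) * Npar c c' n q * m) → (Fin n → ZMod q) × ZMod q) (r : List Bool),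
      r.length = (encodeLWESamples S').length ^ 2 → ∀ (ans : List (List Bool))
      (hlen : Tpar c c' n * (n * q + 1) * Npar c c' n q ≤ ans.length),
      G (boolPair (boolPair (encodeLWESamples S') r) ((encodingList Bool).listBool.encode ans)) =
        encodeSecret (outputB (firstArgmax (Tpar_pos hn)) firstArgmin ⟨0, hn⟩ fun qi =>
          accBit (ans[(qIdxEquiv n q (Npar c c' n q) (Tpar c c' n) qi).val]'(lt_of_lt_of_le (Fin.isLt _) hlen)))

end Literature.Computability.Cryptography

end
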